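import Mathlib.Analysis.Fourier.LpSpace
import Mathlib.Algebra.Order.Chebyshev
import Literature.Analysis.FunctionSpaces.L2TemperedDistribution
import Literature.Analysis.FunctionSpaces.FourierSobolevNormProofs
import Literature.Analysis.FunctionSpaces.PlancherelL1L2
import HarnessLib

/-!
# Smooth functions with all derivatives in `L²`: the Fourier side (moments, inversion, Plancherel)

Analysis/FunctionSpaces support file (all results proved, no definitions, no named facts). It
supplies the classical-analysis bridge used to discharge
`Literature.Analysis.FluidPDE.sobolev_fourierDatum_of_smooth` (`FluidPDE/TaoH1FourierDecomposition`;
Stein–Weiss 1971, Ch. I, Thm. 2.3 (Plancherel) with Thm. 1.8 (transform of a derivative), for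
smooth fields with all derivatives in `L²` — which are in general **not** integrable, so that the
Fourier *integral* of the datum is not available and the `L²` theory must be used).

Setting: `E` a finite-dimensional real inner product space with Lebesgue measure, `f : E → ℂ`
smooth with `∫ ‖Dⁿf‖² < ∞` for every `n` (no decay beyond `L²`), and
`a = 𝓕⁻¹ f ∈ L²` its inverse transform in the sense of Mathlib's `L²` Fourier transform
(`MeasureTheory.Lp.fourierTransformₗᵢ`, notation `𝓕⁻ (hf.toLp f)`; we always work with the
canonical representative `⇑(𝓕⁻ (hf.toLp f))`). Results:

* `lineDerivOp_fnTD_of_memLp` — `∂ᵥ T_f = T_{∂ᵥ f}` in `𝓢'` for `f ∈ C¹` with `f, ∂ᵥf ∈ L²`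
  (integration by parts against Schwartz functions; the tree's `lineDerivOp_fnTD` asks compact
  support), and the stability of the class under `∂ᵥ` (`smooth_l2_fderiv_apply`);
* `smulLeftCLM_inner_pow_fourierInv_fnTD` — **the symbol rule on `𝓢'`**:
  `⟪ξ, v⟫ᵏ • 𝓕⁻¹ T_f = (-(2πi))⁻ᵏ • 𝓕⁻¹ T_{∂ᵥᵏ f}` (Mathlib `fourierInv_lineDerivOp_eq`,
  iterated), whence (`memLp_inner_pow_mul_fourierInv`, by the tree's
  `exists_smulLeftCLM_toTemperedDistribution_eq_iff_memLp` and injectivity of `L² → 𝓢'`)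
  `⟪ξ, v⟫ᵏ a ∈ L²` with `⟪ξ, v⟫ᵏ a = (-(2πi))⁻ᵏ 𝓕⁻¹(∂ᵥᵏ f)` a.e.;
* `lintegral_enorm_sq_fourierInv_eq`, `lintegral_enorm_sq_inner_mul_fourierInv` — **Plancherel
  with the symbol rule**: `∫ ‖a‖² = ∫ ‖f‖²` and `∫ ‖2π⟪ξ, v⟫ a(ξ)‖² dξ = ∫ ‖Df(x) v‖² dx`;
* `memLp_one_add_norm_pow_mul_fourierInv`,
  `lintegral_one_add_norm_pow_mul_enorm_fourierInv_sq_lt_top` — **all polynomial moments**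
  `∫ (1 + ‖ξ‖)^{2m} ‖a‖² < ∞` (coordinates with respect to an orthonormal basis dominate the norm,
  `one_add_norm_pow_le_sum_abs_inner_pow`, by Jensen's inequality), hence
  `integrable_fourierInv_of_smooth` — **`a ∈ L¹`** (Cauchy–Schwarz with `(1 + ‖ξ‖)^{-m}`,
  `2m > dim E`);
* `fourierIntegral_fourierInv_eq_of_smooth` — **Fourier inversion**: the Fourier *integral* of `a`
  is `f` at every point (`𝓕𝓕⁻¹ = id` on `L²`, the tree's `fourier_toLp_ae_eq_fourierIntegral`
  identifying the `L²` transform of an `L¹ ∩ L²` function with its Fourier integral, continuity);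
* `fourierInv_neg_ae_eq_conj_of_smooth` — for real-valued `f`, `a(-ξ) = conj a(ξ)` a.e.
  (`𝓕` of `ξ ↦ conj a(-ξ)` is `conj 𝓕a`, `fourierIntegral_conj_comp_neg`, and `𝓕` is injective on
  `L²`);
* `sum_inner_mul_fourierInv_ae_eq_zero` — for a family `fⱼ` with `∑ⱼ ∂_{vⱼ} fⱼ = 0`
  (a divergence-free field), `∑ⱼ ⟪ξ, vⱼ⟫ aⱼ(ξ) = 0` a.e.

## Mathlib / tree search

Mathlib (this pin): `Lp.fourierTransformₗᵢ` and `Lp.fourier_toTemperedDistribution_eq` /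
`Lp.fourierInv_toTemperedDistribution_eq`, the `𝓢'` calculus `fourierInv_lineDerivOp_eq`,
`smulLeftCLM_smulLeftCLM_apply`, `Lp.ker_toTemperedDistributionCLM_eq_bot`,
`integral_bilinear_hasLineDerivAt_right_eq_neg_left_of_integrable`, `integrable_one_add_norm`,
`pow_sum_le_card_mul_sum_pow`, `Continuous.ae_eq_iff_eq`; no statement linking the classical
hypotheses "`f ∈ C^∞`, `Dⁿf ∈ L²`" to the `L²`/`𝓢'` Fourier transform was found (searched
`fourier`, `iteratedFDeriv`, `MemSobolev` in `Analysis/Distribution`, `Analysis/Fourier`). Tree: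
`fnTD`, `fnTD_apply`, `fnTD_finset_sum`, `lineDerivOp_fnTD` (compact support)
(`L2TemperedDistribution`), `exists_smulLeftCLM_toTemperedDistribution_eq_iff_memLp`,
`smulLeftCLM_toTemperedDistribution_apply` (`FourierSobolevNormProofs`),
`fourier_toLp_ae_eq_fourierIntegral`, `continuous_fourierIntegral` (`PlancherelL1L2`); the
Bessel-scale statements of `SobolevFourierEmbedding` concern `L¹ ∩ L²` functions and are not used.

## References

* E. M. Stein, G. Weiss, *Introduction to Fourier Analysis on Euclidean Spaces*, Princeton UP
  1971, Ch. I, §1 (Thm. 1.8: the transform of `∂ⱼf` is `2πi ξⱼ f̂`) and §2 (Thm. 2.3: Plancherel,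
  `𝓕` extends to a unitary operator of `L²`). [SteinWeiss1971]
-/

noncomputable section

open MeasureTheory TemperedDistribution FourierTransform
open scoped ENNReal LineDeriv Real ContDiff InnerProductSpace ComplexConjugate SchwartzMap

namespace Literature.Analysis.FunctionSpaces

variable {E : Type*} [NormedAddCommGroup E] [InnerProductSpace ℝ E] [FiniteDimensional ℝ E]
  [MeasurableSpace E] [BorelSpace E]

/-! ### `T_f` determines `f`; products with temperate weights -/

/-- Two square-integrable functions with the same tempered distribution agree a.e.
(injectivity of `L² → 𝓢'`, Mathlib `Lp.ker_toTemperedDistributionCLM_eq_bot`). [folklore] -/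
theorem ae_eq_of_fnTD_eq {g h : E → ℂ} (hg : MemLp g 2 (volume : Measure E))
    (hh : MemLp h 2 (volume : Measure E)) (he : fnTD g = fnTD h) : g =ᵐ[volume] h := by
  have hinj : Function.Injective
      (Lp.toTemperedDistributionCLM ℂ (volume : Measure E) 2 : Lp ℂ 2 (volume : Measure E) → _) :=
    LinearMap.ker_eq_bot.1 Lp.ker_toTemperedDistributionCLM_eq_bot
  have h1 : hg.toLp g = hh.toLp h := by
    apply hinj
    rw [fnTD, dif_pos hg, fnTD, dif_pos hh] at he
    simpa only [Lp.toTemperedDistributionCLM_apply] using he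
  exact hg.coeFn_toLp.symm.trans ((Lp.ext_iff.1 h1).trans hh.coeFn_toLp)

/-- The distributional product of a real temperate weight `w` with `T_g`, `g ∈ L²`, is
`T_{w g}` as soon as `w g ∈ L²` (the pairings agree by definition). [folklore] -/
theorem smulLeftCLM_fnTD {w : E → ℝ} (hw : w.HasTemperateGrowth) {g : E → ℂ}
    (hg : MemLp g 2 (volume : Measure E))
    (hwg : MemLp (fun x => (w x : ℂ) * g x) 2 (volume : Measure E)) :
    smulLeftCLM ℂ (fun x => (w x : ℂ)) (fnTD g) = fnTD (fun x => (w x : ℂ) * g x) := by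
  ext u
  rw [fnTD, dif_pos hg, smulLeftCLM_toTemperedDistribution_apply hw, fnTD_apply hwg]
  refine integral_congr_ae ?_
  filter_upwards [hg.coeFn_toLp] with x hx
  rw [hx, smul_eq_mul, Complex.real_smul]

/-- **Distributional = pointwise product.** If `w • T_g = T_h` in `𝓢'` for `g, h ∈ L²` and a
real weight `w` of temperate growth, then `w g ∈ L²` and `w g = h` a.e. (the tree's
`exists_smulLeftCLM_toTemperedDistribution_eq_iff_memLp` and injectivity of `L² → 𝓢'`). [folklore] -/
theorem memLp_and_ae_eq_of_smulLeftCLM_fnTD_eq {w : E → ℝ} (hw : w.HasTemperateGrowth)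
    {g h : E → ℂ} (hg : MemLp g 2 (volume : Measure E)) (hh : MemLp h 2 (volume : Measure E))
    (he : smulLeftCLM ℂ (fun x => (w x : ℂ)) (fnTD g) = fnTD h) :
    MemLp (fun x => (w x : ℂ) * g x) 2 (volume : Measure E) ∧
      (fun x => (w x : ℂ) * g x) =ᵐ[volume] h := by
  have hex : ∃ f' : Lp ℂ 2 (volume : Measure E),
      smulLeftCLM ℂ (fun x ↦ (w x : ℂ)) ((hg.toLp g : Lp ℂ 2 (volume : Measure E)) : 𝓢'(E, ℂ)) =
        f' := by
    refine ⟨hh.toLp h, ?_⟩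
    rw [fnTD, dif_pos hg, fnTD, dif_pos hh] at he
    exact he
  have hm := (exists_smulLeftCLM_toTemperedDistribution_eq_iff_memLp hw (hg.toLp g)).1 hex
  have hm' : MemLp (fun x => (w x : ℂ) * g x) 2 (volume : Measure E) := by
    refine hm.ae_eq ?_
    filter_upwards [hg.coeFn_toLp] with x hx
    rw [hx, Complex.real_smul]
  refine ⟨hm', ?_⟩
  have h2 : fnTD (fun x => (w x : ℂ) * g x) = fnTD h := by rw [← smulLeftCLM_fnTD hw hg hm', he]
  exact ae_eq_of_fnTD_eq hm' hh h2

/-! ### Distributional derivatives of smooth `L²` functions with `L²` derivatives -/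

/-- **Distributional = classical derivative, without compact support**: for `f ∈ C¹` with
`f ∈ L²` and `∂ᵥ f ∈ L²`, `∂ᵥ T_f = T_{∂ᵥ f}` in `𝓢'` (integration by parts against Schwartz
functions; the products are integrable by Cauchy–Schwarz, so no decay of `f` beyond `L²` is
needed; Mathlib's `integral_bilinear_hasLineDerivAt_right_eq_neg_left_of_integrable`). The
compactly supported case is the tree's `lineDerivOp_fnTD`. [folklore] -/
theorem lineDerivOp_fnTD_of_memLp {f : E → ℂ} (hf : ContDiff ℝ 1 f)
    (hf2 : MemLp f 2 (volume : Measure E)) (v : E)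
    (hf'2 : MemLp (fun x => fderiv ℝ f x v) 2 (volume : Measure E)) :
    ∂_{v} (fnTD f) = fnTD (fun x => fderiv ℝ f x v) := by
  ext φ
  rw [lineDerivOp_apply_apply, fnTD_apply hf2, fnTD_apply hf'2]
  have hφ2 : MemLp (φ : E → ℂ) 2 (volume : Measure E) := φ.memLp 2 volume
  have hφ'2 : MemLp ((∂_{v} φ : 𝓢(E, ℂ)) : E → ℂ) 2 (volume : Measure E) := (∂_{v} φ).memLp 2 volume
  have hibp := integral_bilinear_hasLineDerivAt_right_eq_neg_left_of_integrable
    (μ := (volume : Measure E)) (B := ContinuousLinearMap.mul ℝ ℂ) (f := f)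
    (f' := fun x => fderiv ℝ f x v) (g := fun x => φ x) (g' := fun x => fderiv ℝ φ x v) (v := v)
    ?_ ?_ ?_ ?_ ?_
  · simp only [ContinuousLinearMap.mul_apply'] at hibp
    simp only [neg_apply, SchwartzMap.lineDerivOp_apply_eq_fderiv, neg_mul]
    rw [integral_neg]
    simp_rw [mul_comm _ (f _)]
    rw [hibp, neg_neg]
    exact integral_congr_ae (Filter.Eventually.of_forall fun x => mul_comm _ _)
  · exact hf'2.integrable_mul hφ2
  · have h := hf2.integrable_mul hφ'2
    refine h.congr (Filter.Eventually.of_forall fun x => ?_)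
    simp only [Pi.mul_apply, SchwartzMap.lineDerivOp_apply_eq_fderiv,
      ContinuousLinearMap.mul_apply']
  · exact hf2.integrable_mul hφ2
  · intro x _
    exact ((hf.differentiable one_ne_zero) x).hasFDerivAt.hasLineDerivAt v
  · intro x _
    exact (φ.differentiableAt).hasFDerivAt.hasLineDerivAt v

/-! ### Smooth functions with all derivatives in `L²` -/

/-- `‖f‖ₑ² = ‖D⁰f‖ₑ²`: the order-zero hypothesis is square integrability. [folklore] -/
theorem lintegral_enorm_sq_eq_iteratedFDeriv_zero (f : E → ℂ) :
    ∫⁻ x, ‖f x‖ₑ ^ 2 = ∫⁻ x, ‖iteratedFDeriv ℝ 0 f x‖ₑ ^ 2 := by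
  refine lintegral_congr fun x => ?_
  rw [← ofReal_norm, ← ofReal_norm (iteratedFDeriv ℝ 0 f x), norm_iteratedFDeriv_zero]

/-- A smooth function with `∫ ‖D⁰f‖² < ∞` is in `L²`. [folklore] -/
theorem memLp_two_of_smooth {f : E → ℂ} (hf : ContDiff ℝ ∞ f)
    (h0 : ∫⁻ x, ‖iteratedFDeriv ℝ 0 f x‖ₑ ^ 2 < ⊤) : MemLp f 2 (volume : Measure E) := by
  refine ⟨hf.continuous.aestronglyMeasurable, ?_⟩
  rw [eLpNorm_lt_top_iff_lintegral_rpow_enorm_lt_top two_ne_zero ENNReal.ofNat_ne_top]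
  simpa only [ENNReal.toReal_ofNat, ENNReal.rpow_ofNat, lintegral_enorm_sq_eq_iteratedFDeriv_zero]
    using h0

/-- **The class is stable under directional derivatives**: if `f` is smooth with
`∫ ‖Dⁿf‖² < ∞` for all `n`, so is `∂ᵥ f = Df(·) v`, with `‖Dⁿ(∂ᵥ f)‖ ≤ ‖v‖ ‖Dⁿ⁺¹f‖`
(Mathlib `norm_iteratedFDeriv_clm_apply_const`, `norm_iteratedFDeriv_fderiv`). [folklore] -/
theorem smooth_l2_fderiv_apply {f : E → ℂ} (hf : ContDiff ℝ ∞ f)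
    (hn : ∀ n : ℕ, ∫⁻ x, ‖iteratedFDeriv ℝ n f x‖ₑ ^ 2 < ⊤) (v : E) :
    ContDiff ℝ ∞ (fun x => fderiv ℝ f x v) ∧
      ∀ n : ℕ, ∫⁻ x, ‖iteratedFDeriv ℝ n (fun x => fderiv ℝ f x v) x‖ₑ ^ 2 < ⊤ := by
  have hd : ContDiff ℝ ∞ (fderiv ℝ f) := hf.fderiv_right (m := ∞) (by norm_cast)
  refine ⟨hd.clm_apply contDiff_const, fun n => ?_⟩
  have hle : ∀ x, ‖iteratedFDeriv ℝ n (fun x => fderiv ℝ f x v) x‖ₑ ^ 2 ≤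
      ENNReal.ofReal (‖v‖ ^ 2) * ‖iteratedFDeriv ℝ (n + 1) f x‖ₑ ^ 2 := by
    intro x
    have h1 : ‖iteratedFDeriv ℝ n (fun x => fderiv ℝ f x v) x‖ ≤
        ‖v‖ * ‖iteratedFDeriv ℝ (n + 1) f x‖ := by
      rw [← norm_iteratedFDeriv_fderiv]
      exact norm_iteratedFDeriv_clm_apply_const (hd.contDiffAt) (by exact_mod_cast le_top)
    rw [← ofReal_norm, ← ofReal_norm (iteratedFDeriv ℝ (n + 1) f x),
      ← ENNReal.ofReal_pow (norm_nonneg _), ← ENNReal.ofReal_pow (norm_nonneg _),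
      ← ENNReal.ofReal_mul (sq_nonneg _), ← mul_pow]
    exact ENNReal.ofReal_le_ofReal (pow_le_pow_left₀ (norm_nonneg _) h1 2)
  calc ∫⁻ x, ‖iteratedFDeriv ℝ n (fun x => fderiv ℝ f x v) x‖ₑ ^ 2
      ≤ ∫⁻ x, ENNReal.ofReal (‖v‖ ^ 2) * ‖iteratedFDeriv ℝ (n + 1) f x‖ₑ ^ 2 :=
        lintegral_mono hle
    _ = ENNReal.ofReal (‖v‖ ^ 2) * ∫⁻ x, ‖iteratedFDeriv ℝ (n + 1) f x‖ₑ ^ 2 :=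
        lintegral_const_mul' _ _ ENNReal.ofReal_ne_top
    _ < ⊤ := ENNReal.mul_lt_top ENNReal.ofReal_lt_top (hn (n + 1))

/-- Iterated directional derivatives `∂ᵥ^[k] f` stay in the class. [folklore] -/
theorem smooth_l2_iterate_fderiv_apply {f : E → ℂ} (hf : ContDiff ℝ ∞ f)
    (hn : ∀ n : ℕ, ∫⁻ x, ‖iteratedFDeriv ℝ n f x‖ₑ ^ 2 < ⊤) (v : E) (k : ℕ) :
    ContDiff ℝ ∞ ((fun g : E → ℂ => fun x => fderiv ℝ g x v)^[k] f) ∧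
      ∀ n : ℕ, ∫⁻ x, ‖iteratedFDeriv ℝ n ((fun g : E → ℂ => fun x => fderiv ℝ g x v)^[k] f) x‖ₑ ^ 2
        < ⊤ := by
  induction k with
  | zero => exact ⟨hf, hn⟩
  | succ k ih =>
    rw [Function.iterate_succ_apply']
    exact smooth_l2_fderiv_apply ih.1 ih.2 v

/-- `∂ᵥ T_f = T_{∂ᵥ f}` for `f` in the class. [folklore] -/
theorem lineDerivOp_fnTD_of_smooth {f : E → ℂ} (hf : ContDiff ℝ ∞ f)
    (hn : ∀ n : ℕ, ∫⁻ x, ‖iteratedFDeriv ℝ n f x‖ₑ ^ 2 < ⊤) (v : E) :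
    ∂_{v} (fnTD f) = fnTD (fun x => fderiv ℝ f x v) := by
  have h' := smooth_l2_fderiv_apply hf hn v
  exact lineDerivOp_fnTD_of_memLp (hf.of_le (by exact_mod_cast le_top)) (memLp_two_of_smooth hf (hn 0)) v
    (memLp_two_of_smooth h'.1 (h'.2 0))

/-! ### The Fourier side: `⟪ξ, v⟫ᵏ • 𝓕⁻¹T_f = (-2πi)⁻ᵏ 𝓕⁻¹ T_{∂ᵥᵏ f}` -/

/-- One step: `⟪·, v⟫ • 𝓕⁻¹ T_f = (-(2πi))⁻¹ • 𝓕⁻¹ T_{∂ᵥ f}` (Mathlib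
`fourierInv_lineDerivOp_eq`: `𝓕⁻¹(∂ᵥ T) = -(2πi) ⟪·, v⟫ • 𝓕⁻¹ T`). [folklore] -/
theorem smulLeftCLM_inner_fourierInv_fnTD {f : E → ℂ} (hf : ContDiff ℝ ∞ f)
    (hn : ∀ n : ℕ, ∫⁻ x, ‖iteratedFDeriv ℝ n f x‖ₑ ^ 2 < ⊤) (v : E) :
    smulLeftCLM ℂ (fun ξ : E => ((⟪ξ, v⟫_ℝ : ℝ) : ℂ)) (𝓕⁻ (fnTD f)) =
      (-(2 * π * Complex.I))⁻¹ • 𝓕⁻ (fnTD (fun x => fderiv ℝ f x v)) := by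
  have h := fourierInv_lineDerivOp_eq (fnTD f) v
  rw [lineDerivOp_fnTD_of_smooth hf hn v] at h
  have hc : (-(2 * π * Complex.I)) ≠ 0 := by
    simp [Real.pi_ne_zero, Complex.I_ne_zero]
  rw [h, smul_smul, inv_mul_cancel₀ hc, one_smul]

/-- **`⟪ξ, v⟫ᵏ • 𝓕⁻¹ T_f = (-(2πi))⁻ᵏ • 𝓕⁻¹ T_{∂ᵥᵏ f}`** for `f` smooth with all derivatives in
`L²` (induction on `k`; the transform of a derivative is multiplication by the symbol,
Stein–Weiss 1971, Ch. I, Thm. 1.8, here on `𝓢'`). [cite: SteinWeiss1971, Ch. I Thm. 1.8] -/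
theorem smulLeftCLM_inner_pow_fourierInv_fnTD {f : E → ℂ} (hf : ContDiff ℝ ∞ f)
    (hn : ∀ n : ℕ, ∫⁻ x, ‖iteratedFDeriv ℝ n f x‖ₑ ^ 2 < ⊤) (v : E) (k : ℕ) :
    smulLeftCLM ℂ (fun ξ : E => (((⟪ξ, v⟫_ℝ) ^ k : ℝ) : ℂ)) (𝓕⁻ (fnTD f)) =
      ((-(2 * π * Complex.I))⁻¹) ^ k •
        𝓕⁻ (fnTD ((fun g : E → ℂ => fun x => fderiv ℝ g x v)^[k] f)) := by
  induction k with
  | zero =>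
    simp only [pow_zero, Function.iterate_zero, id_eq, one_smul]
    exact smulLeftCLM_const 1 _ |>.trans (one_smul _ _)
  | succ k ih =>
    have hk := smooth_l2_iterate_fderiv_apply hf hn v k
    have hg1 : (fun ξ : E => (((⟪ξ, v⟫_ℝ) ^ k : ℝ) : ℂ)).HasTemperateGrowth := by fun_prop
    have hg2 : (fun ξ : E => ((⟪ξ, v⟫_ℝ : ℝ) : ℂ)).HasTemperateGrowth := by fun_prop
    have hprod : (fun ξ : E => (((⟪ξ, v⟫_ℝ) ^ (k + 1) : ℝ) : ℂ)) =
        (fun ξ : E => (((⟪ξ, v⟫_ℝ) ^ k : ℝ) : ℂ)) * fun ξ : E => ((⟪ξ, v⟫_ℝ : ℝ) : ℂ) := by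
      funext ξ; simp [pow_succ]
    rw [hprod, ← smulLeftCLM_smulLeftCLM_apply hg1 hg2, ih, map_smul,
      smulLeftCLM_inner_fourierInv_fnTD hk.1 hk.2 v, smul_smul, ← pow_succ,
      Function.iterate_succ_apply']


/-! ### The `L²` inverse transform `a = 𝓕⁻¹ f` and its weighted square integrability -/

/-- `𝓕⁻¹ T_f = T_a` with `a` the `L²` inverse Fourier transform of `f` (Mathlib
`Lp.fourierInv_toTemperedDistribution_eq`). [folklore] -/
theorem fourierInv_fnTD_eq {f : E → ℂ} (hf2 : MemLp f 2 (volume : Measure E)) :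
    𝓕⁻ (fnTD f) = fnTD (⇑((𝓕⁻ (hf2.toLp f) : Lp ℂ 2 (volume : Measure E)))) := by
  rw [fnTD, dif_pos hf2, Lp.fourierInv_toTemperedDistribution_eq, fnTD, dif_pos (Lp.memLp _),
    Lp.toLp_coeFn]

/-- **Weighted square integrability of `a = 𝓕⁻¹ f` and the symbol rule, a.e. form.** For `f`
smooth with all derivatives in `L²`, `v ∈ E`, `k ∈ ℕ`, the function `⟪ξ, v⟫ᵏ a(ξ)` is in `L²`
and equals `(-(2πi))⁻ᵏ 𝓕⁻¹(∂ᵥᵏ f)` a.e. (Stein–Weiss 1971, Ch. I, Thm. 1.8 in `L²` form). [cite: SteinWeiss1971, Ch. I Thm. 1.8] -/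
theorem memLp_inner_pow_mul_fourierInv {f : E → ℂ} (hf : ContDiff ℝ ∞ f)
    (hn : ∀ n : ℕ, ∫⁻ x, ‖iteratedFDeriv ℝ n f x‖ₑ ^ 2 < ⊤) (v : E) (k : ℕ) :
    MemLp (fun ξ => (((⟪ξ, v⟫_ℝ) ^ k : ℝ) : ℂ) *
        ((𝓕⁻ ((memLp_two_of_smooth hf (hn 0)).toLp f) : Lp ℂ 2 (volume : Measure E)) : E → ℂ) ξ)
        2 (volume : Measure E) ∧
      (fun ξ => (((⟪ξ, v⟫_ℝ) ^ k : ℝ) : ℂ) *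
        ((𝓕⁻ ((memLp_two_of_smooth hf (hn 0)).toLp f) : Lp ℂ 2 (volume : Measure E)) : E → ℂ) ξ)
        =ᵐ[volume] fun ξ => ((-(2 * π * Complex.I))⁻¹) ^ k *
          ((𝓕⁻ ((memLp_two_of_smooth (smooth_l2_iterate_fderiv_apply hf hn v k).1
            ((smooth_l2_iterate_fderiv_apply hf hn v k).2 0)).toLp
              ((fun g : E → ℂ => fun x => fderiv ℝ g x v)^[k] f)) :
                Lp ℂ 2 (volume : Measure E)) : E → ℂ) ξ := by
  set hk := smooth_l2_iterate_fderiv_apply hf hn v k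
  have h := smulLeftCLM_inner_pow_fourierInv_fnTD hf hn v k
  rw [fourierInv_fnTD_eq (memLp_two_of_smooth hf (hn 0)),
    fourierInv_fnTD_eq (memLp_two_of_smooth hk.1 (hk.2 0)), ← fnTD_const_mul (Lp.memLp _)] at h
  exact memLp_and_ae_eq_of_smulLeftCLM_fnTD_eq (by fun_prop) (Lp.memLp _)
    ((Lp.memLp _).const_mul _) h

/-- `∫ ‖Ψ‖ₑ² = ‖Ψ‖ₑ²` for an `L²` class `Ψ`. [folklore] -/
theorem lintegral_enorm_sq_eq_enorm_sq (Ψ : Lp ℂ 2 (volume : Measure E)) :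
    ∫⁻ x, ‖(Ψ : E → ℂ) x‖ₑ ^ 2 = ‖Ψ‖ₑ ^ 2 := by
  rw [Lp.enorm_def, eLpNorm_eq_lintegral_rpow_enorm_toReal two_ne_zero ENNReal.ofNat_ne_top]
  simp only [ENNReal.toReal_ofNat, ENNReal.rpow_ofNat, one_div]
  rw [← ENNReal.rpow_natCast, ← ENNReal.rpow_mul]
  norm_num

/-- Plancherel for the `L²` inverse transform in `∫⁻` form: `∫ ‖𝓕⁻¹Ψ‖² = ∫ ‖Ψ‖²`. [folklore] -/
theorem lintegral_enorm_sq_fourierInv_Lp (Ψ : Lp ℂ 2 (volume : Measure E)) :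
    ∫⁻ ξ, ‖((𝓕⁻ Ψ : Lp ℂ 2 (volume : Measure E)) : E → ℂ) ξ‖ₑ ^ 2 =
      ∫⁻ x, ‖(Ψ : E → ℂ) x‖ₑ ^ 2 := by
  rw [lintegral_enorm_sq_eq_enorm_sq, lintegral_enorm_sq_eq_enorm_sq, ← ofReal_norm,
    ← ofReal_norm, ← Lp.norm_fourier_eq (𝓕⁻ Ψ : Lp ℂ 2 (volume : Measure E)),
    fourier_fourierInv_eq]

/-- **Plancherel with the symbol rule**: `∫ ‖⟪ξ, v⟫ᵏ a(ξ)‖² = (2π)^{-2k} ∫ ‖∂ᵥᵏ f‖²` for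
`a = 𝓕⁻¹ f`, `f` smooth with all derivatives in `L²` (Stein–Weiss 1971, Ch. I, Thm. 2.3 with
Thm. 1.8). [cite: SteinWeiss1971, Ch. I Thm. 2.3] -/
theorem lintegral_enorm_sq_inner_pow_mul_fourierInv {f : E → ℂ} (hf : ContDiff ℝ ∞ f)
    (hn : ∀ n : ℕ, ∫⁻ x, ‖iteratedFDeriv ℝ n f x‖ₑ ^ 2 < ⊤) (v : E) (k : ℕ) :
    ∫⁻ ξ, ‖(((⟪ξ, v⟫_ℝ) ^ k : ℝ) : ℂ) *
        ((𝓕⁻ ((memLp_two_of_smooth hf (hn 0)).toLp f) : Lp ℂ 2 (volume : Measure E)) : E → ℂ) ξ‖ₑ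
          ^ 2 =
      ‖((-(2 * π * Complex.I))⁻¹) ^ k‖ₑ ^ 2 *
        ∫⁻ x, ‖((fun g : E → ℂ => fun x => fderiv ℝ g x v)^[k] f) x‖ₑ ^ 2 := by
  obtain ⟨-, hae⟩ := memLp_inner_pow_mul_fourierInv hf hn v k
  set hk := smooth_l2_iterate_fderiv_apply hf hn v k
  rw [lintegral_congr_ae (by filter_upwards [hae] with ξ hξ; rw [hξ])]
  simp_rw [enorm_mul, mul_pow]
  rw [lintegral_const_mul' _ _ (ENNReal.pow_ne_top enorm_ne_top), lintegral_enorm_sq_fourierInv_Lp]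
  congr 1
  exact lintegral_congr_ae (by
    filter_upwards [(memLp_two_of_smooth hk.1 (hk.2 0)).coeFn_toLp] with x hx; rw [hx])

/-- The case `k = 0`: `∫ ‖a‖² = ∫ ‖f‖²`. [folklore] -/
theorem lintegral_enorm_sq_fourierInv_eq {f : E → ℂ} (hf : ContDiff ℝ ∞ f)
    (hn : ∀ n : ℕ, ∫⁻ x, ‖iteratedFDeriv ℝ n f x‖ₑ ^ 2 < ⊤) :
    ∫⁻ ξ, ‖((𝓕⁻ ((memLp_two_of_smooth hf (hn 0)).toLp f) : Lp ℂ 2 (volume : Measure E)) : E → ℂ)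
        ξ‖ₑ ^ 2 = ∫⁻ x, ‖f x‖ₑ ^ 2 := by
  rw [lintegral_enorm_sq_fourierInv_Lp]
  exact lintegral_congr_ae (by
    filter_upwards [(memLp_two_of_smooth hf (hn 0)).coeFn_toLp] with x hx; rw [hx])

/-- The case `k = 1`: `∫ ‖2π ⟪ξ, v⟫ a(ξ)‖² = ∫ ‖Df(x) v‖²`. [folklore] -/
theorem lintegral_enorm_sq_inner_mul_fourierInv {f : E → ℂ} (hf : ContDiff ℝ ∞ f)
    (hn : ∀ n : ℕ, ∫⁻ x, ‖iteratedFDeriv ℝ n f x‖ₑ ^ 2 < ⊤) (v : E) :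
    ∫⁻ ξ, ‖((2 * π * ⟪ξ, v⟫_ℝ : ℝ) : ℂ) *
        ((𝓕⁻ ((memLp_two_of_smooth hf (hn 0)).toLp f) : Lp ℂ 2 (volume : Measure E)) : E → ℂ) ξ‖ₑ
          ^ 2 = ∫⁻ x, ‖fderiv ℝ f x v‖ₑ ^ 2 := by
  have h := lintegral_enorm_sq_inner_pow_mul_fourierInv hf hn v 1
  simp only [pow_one, Function.iterate_one] at h
  have hc : ‖(-(2 * π * Complex.I))⁻¹‖ₑ = (ENNReal.ofReal (2 * π))⁻¹ := by
    rw [enorm_inv (by simp [Real.pi_ne_zero, Complex.I_ne_zero]), enorm_neg]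
    congr 1
    rw [← ofReal_norm]
    simp [abs_of_pos Real.pi_pos]
  have h2 : ∀ ξ : E, ‖((2 * π * ⟪ξ, v⟫_ℝ : ℝ) : ℂ) *
      ((𝓕⁻ ((memLp_two_of_smooth hf (hn 0)).toLp f) : Lp ℂ 2 (volume : Measure E)) : E → ℂ) ξ‖ₑ
        ^ 2 = ENNReal.ofReal (2 * π) ^ 2 * ‖(((⟪ξ, v⟫_ℝ) : ℝ) : ℂ) *
      ((𝓕⁻ ((memLp_two_of_smooth hf (hn 0)).toLp f) : Lp ℂ 2 (volume : Measure E)) : E → ℂ) ξ‖ₑ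
        ^ 2 := by
    intro ξ
    have e : ((2 * π * ⟪ξ, v⟫_ℝ : ℝ) : ℂ) *
        ((𝓕⁻ ((memLp_two_of_smooth hf (hn 0)).toLp f) : Lp ℂ 2 (volume : Measure E)) : E → ℂ) ξ =
        ((2 * π : ℝ) : ℂ) * ((((⟪ξ, v⟫_ℝ) : ℝ) : ℂ) *
          ((𝓕⁻ ((memLp_two_of_smooth hf (hn 0)).toLp f) : Lp ℂ 2 (volume : Measure E)) : E → ℂ)
            ξ) := by
      push_cast; ring
    rw [e, enorm_mul, mul_pow]
    congr 2
    rw [← ofReal_norm, Complex.norm_real, Real.norm_eq_abs, abs_of_pos (by positivity)]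
  simp_rw [h2]
  rw [lintegral_const_mul' _ _ (ENNReal.pow_ne_top ENNReal.ofReal_ne_top), h, hc, ← mul_assoc,
    ← mul_pow, ENNReal.mul_inv_cancel (ENNReal.ofReal_pos.2 (by positivity)).ne'
    ENNReal.ofReal_ne_top, one_pow, one_mul]


/-! ### Polynomial weights: `(1 + ‖ξ‖)ᵐ a ∈ L²`, hence `a ∈ L¹` -/

omit [FiniteDimensional ℝ E] [MeasurableSpace E] [BorelSpace E] in
/-- Coordinates dominate the norm: `(1 + ‖ξ‖)ᵐ ≤ (n + 1)ᵐ (1 + ∑ᵢ |⟪ξ, bᵢ⟫|ᵐ)` for an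
orthonormal basis `b` indexed by a type of cardinality `n` (triangle inequality
`‖ξ‖ ≤ ∑ᵢ |⟪ξ, bᵢ⟫|` and Jensen's inequality for `t ↦ tᵐ`). [folklore] -/
theorem one_add_norm_pow_le_sum_abs_inner_pow {ι : Type*} [Fintype ι] (b : OrthonormalBasis ι ℝ E)
    (m : ℕ) (ξ : E) :
    (1 + ‖ξ‖) ^ m ≤ ((Fintype.card ι : ℝ) + 1) ^ m * (1 + ∑ i, |⟪ξ, b i⟫_ℝ| ^ m) := by
  -- the sum over `Option ι` of `t none = 1`, `t (some i) = |⟪ξ, bᵢ⟫|`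
  set t : Option ι → ℝ := fun o => Option.elim o 1 fun i => |⟪ξ, b i⟫_ℝ| with ht
  have ht0 : ∀ o, 0 ≤ t o := by
    rintro (_ | i)
    · simp [ht]
    · simp [ht]
  have hsum : ∑ o, t o = 1 + ∑ i, |⟪ξ, b i⟫_ℝ| := by
    rw [Fintype.sum_option]; simp [ht]
  have hsum' : ∀ k : ℕ, ∑ o, t o ^ k = 1 + ∑ i, |⟪ξ, b i⟫_ℝ| ^ k := by
    intro k; rw [Fintype.sum_option]; simp [ht]
  have hnorm : ‖ξ‖ ≤ ∑ i, |⟪ξ, b i⟫_ℝ| := by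
    calc ‖ξ‖ = ‖∑ i, ⟪b i, ξ⟫_ℝ • b i‖ := by rw [b.sum_repr']
      _ ≤ ∑ i, ‖⟪b i, ξ⟫_ℝ • b i‖ := norm_sum_le _ _
      _ = ∑ i, |⟪ξ, b i⟫_ℝ| := by
          refine Finset.sum_congr rfl fun i _ => ?_
          rw [norm_smul, b.orthonormal.1 i, mul_one, Real.norm_eq_abs, real_inner_comm]
  have hle : 1 + ‖ξ‖ ≤ ∑ o, t o := by rw [hsum]; linarith
  have hcard : (Fintype.card (Option ι) : ℝ) = (Fintype.card ι : ℝ) + 1 := by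
    rw [Fintype.card_option]; push_cast; ring
  cases m with
  | zero => simp
  | succ n =>
    have hJ := pow_sum_le_card_mul_sum_pow (s := Finset.univ) (f := t) (fun o _ => ht0 o) n
    rw [Finset.card_univ, hcard, hsum' (n + 1)] at hJ
    calc (1 + ‖ξ‖) ^ (n + 1) ≤ (∑ o, t o) ^ (n + 1) :=
          pow_le_pow_left₀ (by positivity) hle _
      _ ≤ ((Fintype.card ι : ℝ) + 1) ^ n * (1 + ∑ i, |⟪ξ, b i⟫_ℝ| ^ (n + 1)) := hJ
      _ ≤ ((Fintype.card ι : ℝ) + 1) ^ (n + 1) * (1 + ∑ i, |⟪ξ, b i⟫_ℝ| ^ (n + 1)) := by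
          gcongr
          · exact le_add_of_nonneg_left (by positivity)
          · exact n.le_succ

/-- **`(1 + ‖ξ‖)ᵐ a ∈ L²` for every `m`**, `a = 𝓕⁻¹ f`, `f` smooth with all derivatives in `L²`
(from the coordinate powers `⟪ξ, bᵢ⟫ᵐ a ∈ L²`). [folklore] -/
theorem memLp_one_add_norm_pow_mul_fourierInv {f : E → ℂ} (hf : ContDiff ℝ ∞ f)
    (hn : ∀ n : ℕ, ∫⁻ x, ‖iteratedFDeriv ℝ n f x‖ₑ ^ 2 < ⊤) (m : ℕ) :
    MemLp (fun ξ => (((1 + ‖ξ‖) ^ m : ℝ) : ℂ) *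
        ((𝓕⁻ ((memLp_two_of_smooth hf (hn 0)).toLp f) : Lp ℂ 2 (volume : Measure E)) : E → ℂ) ξ)
        2 (volume : Measure E) := by
  set A : E → ℂ :=
    ((𝓕⁻ ((memLp_two_of_smooth hf (hn 0)).toLp f) : Lp ℂ 2 (volume : Measure E)) : E → ℂ) with hA
  set b := stdOrthonormalBasis ℝ E with hb
  set C : ℝ := ((Fintype.card (Fin (Module.finrank ℝ E)) : ℝ) + 1) ^ m with hC
  have hA2 : MemLp A 2 (volume : Measure E) := Lp.memLp _
  have hcoord : ∀ i, MemLp (fun ξ => (((⟪ξ, b i⟫_ℝ) ^ m : ℝ) : ℂ) * A ξ) 2 (volume : Measure E) :=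
    fun i => (memLp_inner_pow_mul_fourierInv hf hn (b i) m).1
  -- the dominating real function
  have hgL : MemLp (fun ξ => ‖A ξ‖ + ∑ i, ‖(((⟪ξ, b i⟫_ℝ) ^ m : ℝ) : ℂ) * A ξ‖) 2
      (volume : Measure E) :=
    hA2.norm.add (memLp_finsetSum _ fun i _ => (hcoord i).norm)
  have hmeas : AEStronglyMeasurable (fun ξ => (((1 + ‖ξ‖) ^ m : ℝ) : ℂ) * A ξ)
      (volume : Measure E) := by
    refine (Continuous.aestronglyMeasurable ?_).mul (Lp.aestronglyMeasurable _)
    fun_prop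
  refine hgL.of_le_mul (c := C) hmeas (Filter.Eventually.of_forall fun ξ => ?_)
  have h1 : ‖(((1 + ‖ξ‖) ^ m : ℝ) : ℂ) * A ξ‖ = (1 + ‖ξ‖) ^ m * ‖A ξ‖ := by
    rw [norm_mul, Complex.norm_real, Real.norm_eq_abs, abs_of_nonneg (by positivity)]
  have h2 : ∀ i, ‖(((⟪ξ, b i⟫_ℝ) ^ m : ℝ) : ℂ) * A ξ‖ = |⟪ξ, b i⟫_ℝ| ^ m * ‖A ξ‖ := by
    intro i
    rw [norm_mul, Complex.norm_real, Real.norm_eq_abs, abs_pow]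
  have hpos : 0 ≤ ‖A ξ‖ + ∑ i, ‖(((⟪ξ, b i⟫_ℝ) ^ m : ℝ) : ℂ) * A ξ‖ := by positivity
  rw [h1, Real.norm_eq_abs, abs_of_nonneg hpos]
  simp_rw [h2]
  rw [← Finset.sum_mul, ← one_add_mul, ← mul_assoc]
  exact mul_le_mul_of_nonneg_right (one_add_norm_pow_le_sum_abs_inner_pow b m ξ) (norm_nonneg _)

/-- **Weighted square moments of every order**: `∫ (1 + ‖ξ‖)^{2m} ‖a(ξ)‖² dξ < ∞` for
`a = 𝓕⁻¹ f`, `f` smooth with all derivatives in `L²` (`f ∈ H^m` for all `m`, read on the Fourier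
side; Stein–Weiss 1971, Ch. I, Thm. 1.8 + Thm. 2.3). [cite: SteinWeiss1971, Ch. I Thm. 2.3] -/
theorem lintegral_one_add_norm_pow_mul_enorm_fourierInv_sq_lt_top {f : E → ℂ}
    (hf : ContDiff ℝ ∞ f) (hn : ∀ n : ℕ, ∫⁻ x, ‖iteratedFDeriv ℝ n f x‖ₑ ^ 2 < ⊤) (m : ℕ) :
    ∫⁻ ξ, ENNReal.ofReal ((1 + ‖ξ‖) ^ (2 * m)) *
        ‖((𝓕⁻ ((memLp_two_of_smooth hf (hn 0)).toLp f) : Lp ℂ 2 (volume : Measure E)) : E → ℂ)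
          ξ‖ₑ ^ 2 < ⊤ := by
  have h := memLp_one_add_norm_pow_mul_fourierInv hf hn m
  have h2 := lintegral_rpow_enorm_lt_top_of_eLpNorm_lt_top two_ne_zero ENNReal.ofNat_ne_top h.2
  simp only [ENNReal.toReal_ofNat, ENNReal.rpow_ofNat] at h2
  refine lt_of_le_of_lt (le_of_eq (lintegral_congr fun ξ => ?_)) h2
  rw [enorm_mul, mul_pow]
  congr 1
  rw [← ofReal_norm, Complex.norm_real, Real.norm_eq_abs, abs_of_nonneg (by positivity),
    ← ENNReal.ofReal_pow (by positivity), ← pow_mul, mul_comm m 2]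

/-- **`a = 𝓕⁻¹ f ∈ L¹`** for `f` smooth with all derivatives in `L²`: Cauchy–Schwarz with the
weight `(1 + ‖ξ‖)^{-m}`, `2m > dim E` (Mathlib `integrable_one_add_norm`). [folklore] -/
theorem integrable_fourierInv_of_smooth {f : E → ℂ} (hf : ContDiff ℝ ∞ f)
    (hn : ∀ n : ℕ, ∫⁻ x, ‖iteratedFDeriv ℝ n f x‖ₑ ^ 2 < ⊤) :
    Integrable
      ((𝓕⁻ ((memLp_two_of_smooth hf (hn 0)).toLp f) : Lp ℂ 2 (volume : Measure E)) : E → ℂ) := by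
  set A : E → ℂ :=
    ((𝓕⁻ ((memLp_two_of_smooth hf (hn 0)).toLp f) : Lp ℂ 2 (volume : Measure E)) : E → ℂ) with hA
  set m : ℕ := Module.finrank ℝ E + 1 with hm
  have hw : MemLp (fun ξ : E => ((((1 + ‖ξ‖) ^ m)⁻¹ : ℝ) : ℂ)) 2 (volume : Measure E) := by
    refine MemLp.ofReal ?_
    have hmeas : AEStronglyMeasurable (fun ξ : E => ((1 + ‖ξ‖) ^ m)⁻¹) (volume : Measure E) := by
      refine Continuous.aestronglyMeasurable ?_
      refine Continuous.inv₀ (by fun_prop) fun ξ => by positivity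
    have hI := integrable_one_add_norm (E := E) (μ := volume) (r := (2 * m : ℝ))
      (by rw [hm]; push_cast; linarith)
    refine (memLp_two_iff_integrable_sq hmeas).2 (hI.congr (Filter.Eventually.of_forall fun ξ => ?_))
    have h0 : 0 < 1 + ‖ξ‖ := by positivity
    simp only
    rw [← inv_pow, ← pow_mul, Real.rpow_neg h0.le,
      show ((2 : ℝ) * m) = ((m * 2 : ℕ) : ℝ) by push_cast; ring, Real.rpow_natCast, inv_pow]
  have hprod := hw.integrable_mul (memLp_one_add_norm_pow_mul_fourierInv hf hn m)
  refine hprod.congr (Filter.Eventually.of_forall fun ξ => ?_)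
  have h0 : ((1 + ‖ξ‖) ^ m : ℝ) ≠ 0 := by positivity
  simp only [Pi.mul_apply]
  rw [← mul_assoc, ← Complex.ofReal_mul, inv_mul_cancel₀ h0, Complex.ofReal_one, one_mul]

/-! ### Fourier inversion: `𝓕 a = f` everywhere -/

/-- **Fourier inversion for smooth functions with all derivatives in `L²`**: with `a = 𝓕⁻¹ f`
(the `L²` inverse transform, an integrable function), the Fourier *integral* of `a` is `f` at every
point: `𝓕 a = f` a.e. by Plancherel (`𝓕 𝓕⁻¹ = id` on `L²` and the tree's
`fourier_toLp_ae_eq_fourierIntegral`), and both sides are continuous (Stein–Weiss 1971, Ch. I,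
Thm. 2.3 with Cor. 1.21). [cite: SteinWeiss1971, Ch. I Thm. 2.3] -/
theorem fourierIntegral_fourierInv_eq_of_smooth {f : E → ℂ} (hf : ContDiff ℝ ∞ f)
    (hn : ∀ n : ℕ, ∫⁻ x, ‖iteratedFDeriv ℝ n f x‖ₑ ^ 2 < ⊤) :
    𝓕 ((𝓕⁻ ((memLp_two_of_smooth hf (hn 0)).toLp f) : Lp ℂ 2 (volume : Measure E)) : E → ℂ) =
      f := by
  set hf2 := memLp_two_of_smooth hf (hn 0)
  set A : E → ℂ := ((𝓕⁻ (hf2.toLp f) : Lp ℂ 2 (volume : Measure E)) : E → ℂ) with hA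
  have hA1 : Integrable A := integrable_fourierInv_of_smooth hf hn
  have hA2 : MemLp A 2 (volume : Measure E) := Lp.memLp _
  have hL : hA2.toLp A = (𝓕⁻ (hf2.toLp f) : Lp ℂ 2 (volume : Measure E)) := Lp.toLp_coeFn _ _
  have hae : 𝓕 A =ᵐ[volume] f := by
    have h1 := fourier_toLp_ae_eq_fourierIntegral hA1 hA2
    rw [hL, fourier_fourierInv_eq] at h1
    exact h1.symm.trans hf2.coeFn_toLp
  exact (Continuous.ae_eq_iff_eq volume (continuous_fourierIntegral hA1) hf.continuous).1 hae

/-! ### Reality of `f`: conjugation symmetry of `a` -/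

omit [FiniteDimensional ℝ E] [MeasurableSpace E] [BorelSpace E] in
/-- Pointwise: `𝐞(-⟪-v, x⟫) • conj z = conj (𝐞(-⟪v, x⟫) • z)`. [folklore] -/
theorem fourierChar_neg_inner_neg_smul_conj (v x : E) (z : ℂ) :
    (𝐞 (-⟪-v, x⟫_ℝ) : ℂ) * conj z = conj ((𝐞 (-⟪v, x⟫_ℝ) : ℂ) * z) := by
  rw [map_mul, ← Circle.coe_inv_eq_conj, ← AddChar.map_neg_eq_inv, inner_neg_left, neg_neg]

/-- **The Fourier integral of `ξ ↦ conj a(-ξ)` is the conjugate of `𝓕 a`** (for any `a`; both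
sides are related by the reflection `ξ ↦ -ξ` and complex conjugation, which commute with the
Bochner integral). [folklore] -/
theorem fourierIntegral_conj_comp_neg (a : E → ℂ) (x : E) :
    𝓕 (fun ξ => conj (a (-ξ))) x = conj (𝓕 a x) := by
  rw [Real.fourier_eq, Real.fourier_eq, ← integral_conj,
    ← integral_neg_eq_self (fun v => (starRingEnd ℂ) (𝐞 (-⟪v, x⟫_ℝ) • a v)) volume]
  refine integral_congr_ae (Filter.Eventually.of_forall fun v => ?_)
  simp only [Circle.smul_def, smul_eq_mul]
  have h := fourierChar_neg_inner_neg_smul_conj (-v) x (a (-v))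
  rwa [neg_neg] at h

/-- **Conjugation symmetry of `a = 𝓕⁻¹ f` for real-valued `f`**: if `conj ∘ f = f` then
`a(-ξ) = conj a(ξ)` for a.e. `ξ` (both `a` and `ξ ↦ conj a(-ξ)` are `L¹ ∩ L²` functions with the
same Fourier integral `f`, hence the same `L²` transform, and `𝓕` is injective on `L²`). [folklore] -/
theorem fourierInv_neg_ae_eq_conj_of_smooth {f : E → ℂ} (hf : ContDiff ℝ ∞ f)
    (hn : ∀ n : ℕ, ∫⁻ x, ‖iteratedFDeriv ℝ n f x‖ₑ ^ 2 < ⊤) (hreal : ∀ x, conj (f x) = f x) :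
    ∀ᵐ ξ ∂(volume : Measure E),
      ((𝓕⁻ ((memLp_two_of_smooth hf (hn 0)).toLp f) : Lp ℂ 2 (volume : Measure E)) : E → ℂ) (-ξ) =
        conj (((𝓕⁻ ((memLp_two_of_smooth hf (hn 0)).toLp f) : Lp ℂ 2 (volume : Measure E)) :
          E → ℂ) ξ) := by
  set hf2 := memLp_two_of_smooth hf (hn 0)
  set A : E → ℂ := ((𝓕⁻ (hf2.toLp f) : Lp ℂ 2 (volume : Measure E)) : E → ℂ) with hA
  have hA1 : Integrable A := integrable_fourierInv_of_smooth hf hn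
  have hA2 : MemLp A 2 (volume : Measure E) := Lp.memLp _
  set B : E → ℂ := fun ξ => conj (A (-ξ)) with hB
  have hB1 : Integrable B := by
    have h := hA1.comp_neg
    exact (Complex.conjLIE.toContinuousLinearEquiv.toContinuousLinearMap.integrable_comp h :)
  have hB2 : MemLp B 2 (volume : Measure E) := by
    have h : MemLp (fun ξ => A (-ξ)) 2 (volume : Measure E) :=
      hA2.comp_measurePreserving (Measure.measurePreserving_neg (volume : Measure E))
    have hnorm : ∀ᵐ ξ ∂(volume : Measure E), ‖B ξ‖ = ‖A (-ξ)‖ :=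
      Filter.Eventually.of_forall fun ξ => by simp only [hB, Complex.norm_conj]
    exact ⟨Complex.continuous_conj.comp_aestronglyMeasurable h.1, by
      rw [eLpNorm_congr_norm_ae hnorm]; exact h.2⟩
  -- same Fourier integral
  have hFB : 𝓕 B = 𝓕 A := by
    funext x
    rw [hB, fourierIntegral_conj_comp_neg, hA, fourierIntegral_fourierInv_eq_of_smooth hf hn, hreal]
  -- hence the same `L²` transform, hence `B = A` a.e.
  have hLp : hB2.toLp B = hA2.toLp A := by
    have h1 := fourier_toLp_ae_eq_fourierIntegral hB1 hB2
    have h2 := fourier_toLp_ae_eq_fourierIntegral hA1 hA2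
    rw [hFB] at h1
    have h3 : (𝓕 (hB2.toLp B) : Lp ℂ 2 (volume : Measure E)) = 𝓕 (hA2.toLp A) :=
      Lp.ext (h1.trans h2.symm)
    have h4 := congrArg (fun Ψ : Lp ℂ 2 (volume : Measure E) => (𝓕⁻ Ψ : Lp ℂ 2 (volume : Measure E))) h3
    simpa only [fourierInv_fourier_eq] using h4
  have hae : B =ᵐ[volume] A := hB2.coeFn_toLp.symm.trans ((Lp.ext_iff.1 hLp).trans hA2.coeFn_toLp)
  filter_upwards [hae] with ξ hξ
  rw [hB] at hξ
  simp only at hξ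
  rw [← hξ, Complex.conj_conj]

/-! ### Linear combinations: the symbol of `∑ⱼ ∂_{vⱼ} fⱼ` -/

/-- **Symbol rule for a first-order combination**: for `fⱼ` smooth with all derivatives in `L²`
and vectors `vⱼ`, `T_{∑ⱼ ⟪ξ, vⱼ⟫ aⱼ} = (-(2πi))⁻¹ 𝓕⁻¹ T_{∑ⱼ ∂_{vⱼ} fⱼ}` with `aⱼ = 𝓕⁻¹ fⱼ`; in
particular if `∑ⱼ ∂_{vⱼ} fⱼ = 0` (e.g. a divergence-free field) then `∑ⱼ ⟪ξ, vⱼ⟫ aⱼ(ξ) = 0`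
a.e. [folklore] -/
theorem sum_inner_mul_fourierInv_ae_eq_zero {ι : Type*} [Fintype ι] {f : ι → E → ℂ}
    (hf : ∀ j, ContDiff ℝ ∞ (f j))
    (hn : ∀ j, ∀ n : ℕ, ∫⁻ x, ‖iteratedFDeriv ℝ n (f j) x‖ₑ ^ 2 < ⊤) (v : ι → E)
    (hdiv : ∀ x, ∑ j, fderiv ℝ (f j) x (v j) = 0) :
    ∀ᵐ ξ ∂(volume : Measure E),
      ∑ j, ((⟪ξ, v j⟫_ℝ : ℝ) : ℂ) *
        ((𝓕⁻ ((memLp_two_of_smooth (hf j) (hn j 0)).toLp (f j)) : Lp ℂ 2 (volume : Measure E)) :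
          E → ℂ) ξ = 0 := by
  -- each term
  have hterm : ∀ j, MemLp (fun ξ => ((⟪ξ, v j⟫_ℝ : ℝ) : ℂ) *
      ((𝓕⁻ ((memLp_two_of_smooth (hf j) (hn j 0)).toLp (f j)) : Lp ℂ 2 (volume : Measure E)) :
        E → ℂ) ξ) 2 (volume : Measure E) ∧
      fnTD (fun ξ => ((⟪ξ, v j⟫_ℝ : ℝ) : ℂ) *
        ((𝓕⁻ ((memLp_two_of_smooth (hf j) (hn j 0)).toLp (f j)) : Lp ℂ 2 (volume : Measure E)) :
          E → ℂ) ξ) =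
        (-(2 * π * Complex.I))⁻¹ • 𝓕⁻ (fnTD (fun x => fderiv ℝ (f j) x (v j))) := by
    intro j
    have hm := (memLp_inner_pow_mul_fourierInv (hf j) (hn j) (v j) 1).1
    simp only [pow_one] at hm
    refine ⟨hm, ?_⟩
    rw [← smulLeftCLM_fnTD (by fun_prop) (Lp.memLp _) hm,
      ← fourierInv_fnTD_eq (memLp_two_of_smooth (hf j) (hn j 0)),
      smulLeftCLM_inner_fourierInv_fnTD (hf j) (hn j)]
  have hsumL : MemLp (fun ξ => ∑ j, ((⟪ξ, v j⟫_ℝ : ℝ) : ℂ) *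
      ((𝓕⁻ ((memLp_two_of_smooth (hf j) (hn j 0)).toLp (f j)) : Lp ℂ 2 (volume : Measure E)) :
        E → ℂ) ξ) 2 (volume : Measure E) :=
    memLp_finsetSum _ fun j _ => (hterm j).1
  have hd : ∀ j, MemLp (fun x => fderiv ℝ (f j) x (v j)) 2 (volume : Measure E) := fun j =>
    memLp_two_of_smooth (smooth_l2_fderiv_apply (hf j) (hn j) (v j)).1
      ((smooth_l2_fderiv_apply (hf j) (hn j) (v j)).2 0)
  have hT : fnTD (fun ξ => ∑ j, ((⟪ξ, v j⟫_ℝ : ℝ) : ℂ) *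
      ((𝓕⁻ ((memLp_two_of_smooth (hf j) (hn j 0)).toLp (f j)) : Lp ℂ 2 (volume : Measure E)) :
        E → ℂ) ξ) = fnTD (fun _ : E => (0 : ℂ)) := by
    rw [fnTD_finset_sum _ fun j _ => (hterm j).1]
    simp_rw [(hterm _).2]
    rw [← Finset.smul_sum, ← fourierInv_sum, ← fnTD_finset_sum _ fun j _ => hd j]
    simp_rw [hdiv]
    have h0 : fnTD (fun _ : E => (0 : ℂ)) = 0 := by
      ext φ
      rw [fnTD_apply MemLp.zero']
      simp
    rw [h0, fourierInv_zero, smul_zero]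
  have hae := ae_eq_of_fnTD_eq hsumL (MemLp.zero' (ε := ℂ)) hT
  exact hae

end Literature.Analysis.FunctionSpaces

end
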